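import Literature.Probability.LatticeModels.TriangularLatticeProofs
import Literature.Probability.RandomPlanarGeometry.MarkedDomainCorners
import Mathlib.Topology.MetricSpace.HausdorffDistance

/-!
# The frame change `g(x + iy) = x + y ζ` between `δℤ²` and `δ𝕋` (support item `SmirnovCellAnchor`)

Helper file for `Summit.CriticalPhenomena.CardyFormulaZ2.Theses.ModulusResponse.SmirnovCellAnchor`
(stmt-CriticalPhenomena-6471). The indexing set `Site 2 = ℤ²` of the cell model carries two
positions: the square-lattice mesh point `meshPoint δ x = δ (x₀ + i x₁)` (G02's `ℤ²` recipe) and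
the equilateral position `triMeshPoint δ x = δ (x₀ + x₁ ζ)`, `ζ = e^{iπ/3}` (the `𝕋` machinery of
Bollobás–Riordan Ch. 7 in the tree). They differ by the real-linear map `g(x + iy) = x + y ζ`
(pinned by the hypothesis `hg`): `g (meshPoint δ x) = triMeshPoint δ x`. We record the crude
distortion bounds `‖z‖ / 2 ≤ ‖g z‖ ≤ 2 ‖z‖` and their consequences for distances and `infDist`,
and a corner-separation lemma for conformal rectangles: a point at distance `≥ ρ₀` from the four
marked points which is close to one arc is not close to any other arc
(`far_arc_of_far_corners`, from `MarkedDomain.exists_corner_modulus`).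
-/

noncomputable section

namespace Summit.CriticalPhenomena.CardyFormulaZ2.Theorems.SmirnovCellAnchor

open Set Metric Complex
open Literature.Probability.LatticeModels Literature.Probability.RandomPlanarGeometry

/-! ### The frame map -/

section Frame

variable (g : ℂ → ℂ) (hg : ∀ z, g z = (z.re : ℂ) + (z.im : ℂ) * triZeta)
include hg

/-- `g` carries square-lattice mesh points to equilateral mesh points. [folklore] -/
theorem g_meshPoint (δ : ℝ) (x : Site 2) : g (meshPoint δ x) = triMeshPoint δ x := by
  rw [hg, meshPoint_re, meshPoint_im, triMeshPoint, triEmbed]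
  push_cast
  ring

/-- `g` is additive. [folklore] -/
theorem g_sub (z w : ℂ) : g z - g w = g (z - w) := by
  rw [hg, hg, hg, sub_re, sub_im]; push_cast; ring

/-- `g 0 = 0`. [folklore] -/
theorem g_zero : g 0 = 0 := by rw [hg]; simp

/-- The squared norm of `g z` is the positive definite form `x² + xy + y²`. [folklore] -/
theorem norm_g_sq (z : ℂ) : ‖g z‖ ^ 2 = z.re ^ 2 + z.re * z.im + z.im ^ 2 := by
  rw [hg, Complex.sq_norm, Complex.normSq_apply]
  simp only [add_re, ofReal_re, mul_re, ofReal_im, triZeta_re, triZeta_im, zero_mul, sub_zero,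
    add_im, mul_im, zero_add]
  have h3 : Real.sqrt 3 * Real.sqrt 3 = 3 := Real.mul_self_sqrt (by norm_num)
  nlinarith [h3]

/-- **Distortion of the frame map**: `‖z‖ ≤ 2 ‖g z‖`. [folklore] -/
theorem norm_le_two_mul_norm_g (z : ℂ) : ‖z‖ ≤ 2 * ‖g z‖ := by
  have h1 : ‖z‖ ^ 2 = z.re ^ 2 + z.im ^ 2 := by rw [Complex.sq_norm, Complex.normSq_apply]; ring
  have h2 := norm_g_sq g hg z
  have h3 : ‖z‖ ^ 2 ≤ (2 * ‖g z‖) ^ 2 := by nlinarith [sq_nonneg (z.re + z.im)]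
  exact (sq_le_sq₀ (norm_nonneg _) (by positivity)).1 h3

/-- **Distortion of the frame map**: `‖g z‖ ≤ 2 ‖z‖`. [folklore] -/
theorem norm_g_le_two_mul_norm (z : ℂ) : ‖g z‖ ≤ 2 * ‖z‖ := by
  have h1 : ‖z‖ ^ 2 = z.re ^ 2 + z.im ^ 2 := by rw [Complex.sq_norm, Complex.normSq_apply]; ring
  have h2 := norm_g_sq g hg z
  have h3 : ‖g z‖ ^ 2 ≤ (2 * ‖z‖) ^ 2 := by nlinarith [sq_nonneg (z.re - z.im)]
  exact (sq_le_sq₀ (norm_nonneg _) (by positivity)).1 h3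

/-- Distances shrink by at most a factor `2` under `g`. [folklore] -/
theorem dist_le_two_mul_dist_g (z w : ℂ) : dist z w ≤ 2 * dist (g z) (g w) := by
  rw [dist_eq_norm, dist_eq_norm, g_sub g hg]; exact norm_le_two_mul_norm_g g hg _

/-- Distances grow by at most a factor `2` under `g`. [folklore] -/
theorem dist_g_le_two_mul_dist (z w : ℂ) : dist (g z) (g w) ≤ 2 * dist z w := by
  rw [dist_eq_norm, dist_eq_norm, g_sub g hg]; exact norm_g_le_two_mul_norm g hg _

/-- `g` is injective. [folklore] -/
theorem g_injective : Function.Injective g := fun z w h => by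
  have := dist_le_two_mul_dist_g g hg z w
  rw [h, dist_self, mul_zero] at this
  exact dist_le_zero.1 this

/-- Membership transfer along `g`. [folklore] -/
theorem g_mem_image_iff {z : ℂ} {A : Set ℂ} : g z ∈ g '' A ↔ z ∈ A :=
  (g_injective g hg).mem_set_image

/-- `infDist` shrinks by at most a factor `2` under `g`. [folklore] -/
theorem infDist_le_two_mul_infDist_g (z : ℂ) (A : Set ℂ) :
    infDist z A ≤ 2 * infDist (g z) (g '' A) := by
  rcases A.eq_empty_or_nonempty with rfl | hA
  · simp
  have h : infDist z A / 2 ≤ infDist (g z) (g '' A) := by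
    refine (le_infDist (hA.image g)).2 ?_
    rintro _ ⟨a, ha, rfl⟩
    have := infDist_le_dist_of_mem (x := z) ha
    have := dist_le_two_mul_dist_g g hg z a
    linarith
  linarith

/-- `infDist` grows by at most a factor `2` under `g`. [folklore] -/
theorem infDist_g_le_two_mul_infDist (z : ℂ) (A : Set ℂ) :
    infDist (g z) (g '' A) ≤ 2 * infDist z A := by
  rcases A.eq_empty_or_nonempty with rfl | hA
  · simp
  have h : infDist (g z) (g '' A) / 2 ≤ infDist z A := by
    refine (le_infDist hA).2 fun a ha => ?_
    have := infDist_le_dist_of_mem (x := g z) (mem_image_of_mem g ha)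
    have := dist_g_le_two_mul_dist g hg z a
    linarith
  linarith

/-- A lower bound on `infDist` in the `𝕋` frame gives half the bound in the `ℤ²` frame. [folklore] -/
theorem half_le_infDist_of_le_infDist_g {z : ℂ} {A : Set ℂ} {r : ℝ} (h : r ≤ infDist (g z) (g '' A)) :
    r / 2 ≤ infDist z A := by
  have := infDist_g_le_two_mul_infDist g hg z A; linarith

/-- An upper bound on `infDist` in the `𝕋` frame gives twice the bound in the `ℤ²` frame. [folklore] -/
theorem infDist_le_two_mul_of_infDist_g_le {z : ℂ} {A : Set ℂ} {r : ℝ} (h : infDist (g z) (g '' A) ≤ r) :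
    infDist z A ≤ 2 * r := by
  have := infDist_le_two_mul_infDist_g g hg z A; linarith

/-- A lower bound on distances in the `𝕋` frame gives half the bound in the `ℤ²` frame. [folklore] -/
theorem half_le_dist_of_le_dist_g {z w : ℂ} {r : ℝ} (h : r ≤ dist (g z) (g w)) : r / 2 ≤ dist z w := by
  have := dist_g_le_two_mul_dist g hg z w; linarith

end Frame

/-! ### Corner separation in a conformal rectangle -/

/-- **Far from the corners, the arcs keep apart**: for `ρ₀ > 0` there is `κ > 0` such that a point
at distance `≥ ρ₀` from the four marked points of the conformal rectangle `Q` and within `κ` of the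
arc `i` is at distance `≥ κ` from every other arc `k ≠ i` (two arcs approach each other only at a
common marked point, `MarkedDomain.exists_corner_modulus`). [folklore] -/
theorem far_arc_of_far_corners (Q : ConformalRectangle) {ρ₀ : ℝ} (hρ₀ : 0 < ρ₀) :
    ∃ κ > 0, ∀ z : ℂ, (∀ j : Fin 4, ρ₀ ≤ dist z (Q.pt j)) → ∀ i k : Fin 4, k ≠ i →
      infDist z (Q.arc i) < κ → κ ≤ infDist z (Q.arc k) := by
  obtain ⟨η, hη, hcm⟩ := Q.exists_corner_modulus (half_pos hρ₀)
  refine ⟨min (η / 2) (ρ₀ / 2), by positivity, fun z hfar i k hik hzi => ?_⟩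
  by_contra hzk
  push Not at hzk
  have hκη : min (η / 2) (ρ₀ / 2) ≤ η / 2 := min_le_left _ _
  have hκρ : min (η / 2) (ρ₀ / 2) ≤ ρ₀ / 2 := min_le_right _ _
  obtain ⟨a, ha, hda⟩ := (Q.isCompact_arc i).exists_infDist_eq_dist ⟨_, Q.pt_mem_arc_self i⟩ z
  have hafr : a ∈ frontier Q.carrier := Q.arc_subset_frontier i ha
  have hai : infDist a (Q.arc i) < η := by rw [infDist_zero_of_mem ha]; exact hη
  have hak : infDist a (Q.arc k) < η := by
    have := infDist_le_infDist_add_dist (s := Q.arc k) (x := a) (y := z)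
    rw [dist_comm] at this
    linarith
  obtain ⟨m, -, -, hm⟩ := hcm a hafr i k hik hai hak
  have := hfar m
  have := dist_triangle z a (Q.pt m)
  linarith

end Summit.CriticalPhenomena.CardyFormulaZ2.Theorems.SmirnovCellAnchor

end
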